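import Summits.Parity.BatemanHorn.Theorems.SoloInformedLocatedMangoldt
import Summits.Parity.BatemanHorn.Theorems.SoloInformedPrimePowerNegligible
import Literature.NumberTheory.Sieve.AletheiaZomleferFukshanskyGarcia2020Applications

/-!
# SoloInformedPrimeLayerBias — the conjecture as a secondary-term statement for the prime-vanishing weight `μ·log + Λ`

Solo unit `solo-Parity-informed` (ideation tier, informed mode), session 19; `PLAN.md` §26–§27, CLAIMS C94.

The weight `ν := μ·log + Λ` VANISHES AT PRIMES (`μ(p) log p + Λ(p) = 0`); it is `log p` at the prime powers
`p^a`, `a ≥ 2`, `μ(m) log m` at square-free composites, and `0` elsewhere. Adding the located `Λ`-layer of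
`SoloInformedLocatedMangoldt` (Theorem A) to the tree's large-divisor Möbius–log form `T_g(x; x^{1-ε})` of the
conjecture (`batemanHornAsymptotic_iff_largeDivisorSum_isLittleO_rpowCut`) cancels the prime layer exactly:

**Corollary B** (`LocatedMangoldt.batemanHornAsymptotic_iff_compositeLayers`). For every one-polynomial
Bateman–Horn system `g` of degree `d ≥ 2`, leading coefficient `a`, and every `0 < ε < 1`,

  `BatemanHornAsymptotic ![g] ⟺ ∑_{n ≤ x} ∑_{m ∣ g(n), m > x^{1-ε}} (μ(m) log m + Λ(m))
                                  = (d - 1 + ε) x log x - (d - log a - γ_g) x + o(x)`,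

`γ_g` the Mertens constant of `g`. **Hardy–Littlewood's Conjecture E** (`LocatedMangoldt.conjE_iff_compositeLayers`):

  `HL-E ⟺ ∑_{n ≤ x} ∑_{m ∣ n²+1, m > x^{1-ε}} (μ(m) log m + Λ(m)) = (1 + ε) x log x - (2 - γ_{X²+1}) x + o(x)`.

So the composite (square-free and prime-power) layers beyond `x^{1-ε}` must produce not only the leading
`(1+ε) x log x` but the definite NEGATIVE secondary term `-(2 - γ_{X²+1}) x ≈ -0.3731 x` (numerics of the unit,
CLAIMS C91: `-0.37310, -0.37264, -0.37332, -0.37311` at `x = 10⁶, …, 10⁹` for the prime layer's deficit). This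
makes precise, and kernel-checks, the remark that the parity-sensitive content of HL-E sits in a lower-order term
of a sum whose main terms are sieve-theoretically trivial [Hooley1976, Ch. 2; Merikoski2022].
-/

namespace Summit.Parity.BatemanHorn.Theorems

open Finset Filter ArithmeticFunction Asymptotics Polynomial
open scoped Topology ArithmeticFunction.Moebius
open Literature.NumberTheory.Sieve (polyRootCountMod IsBatemanHornSystem BatemanHornAsymptotic)

namespace LocatedMangoldt

/-- Reindexing the tree's `T_g` inner sum by the cofactor and adding the located `Λ`-sum:
`∑_{e ∣ N, y < N/e} μ(N/e) log(N/e) + ∑_{m ∣ N, y < m} Λ(m) = ∑_{m ∣ N, y < m} (μ(m) log m + Λ(m))`. -/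
theorem inner_moebiusLog_add_vonMangoldt (N y : ℕ) :
    ∑ e ∈ N.divisors with y < N / e, (μ (N / e) : ℝ) * Real.log (((N / e : ℕ)) : ℝ)
      + ∑ m ∈ N.divisors with y < m, Λ m
      = ∑ m ∈ N.divisors with y < m, ((μ m : ℝ) * Real.log m + Λ m) := by
  rw [sum_add_distrib]
  congr 1
  rw [sum_filter, sum_filter]
  exact Nat.sum_div_divisors N (fun m => if y < m then (μ m : ℝ) * Real.log m else 0)

/-- **Corollary B (the conjecture as a secondary-term statement).** For a one-polynomial Bateman–Horn system `g`
of degree `d ≥ 2` with leading coefficient `a` and `0 < ε < 1`: `BatemanHornAsymptotic ![g]` holds iff the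
located sum of the PRIME-VANISHING weight `ν = μ·log + Λ` (supported on the prime powers `p^a`, `a ≥ 2`, and the
square-free composites) over the divisors `m > x^{1-ε}` of the values carries the full main term of Theorem A:
`∑_{n ≤ x} ∑_{m ∣ g(n), m > x^{1-ε}} (μ(m) log m + Λ(m)) = (d-1+ε) x log x - (d - log a - γ_g) x + o(x)`. -/
theorem batemanHornAsymptotic_iff_compositeLayers {g : ℤ[X]} (hg : IsBatemanHornSystem ![g])
    (hdeg : 2 ≤ g.natDegree) {ε : ℝ} (hε : 0 < ε) (hε1 : ε < 1) :
    ∃ γ : ℝ,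
      Tendsto (fun N : ℕ => ∑ e ∈ Icc 1 N, Λ e * (polyRootCountMod ![g] e : ℝ) / e - Real.log N)
        atTop (𝓝 (-γ)) ∧
      (BatemanHornAsymptotic ![g] ↔
        (fun x : ℕ => ∑ n ∈ Icc 1 x, ∑ m ∈ ((g.eval (n : ℤ)).natAbs.divisors) with ⌊(x : ℝ) ^ (1 - ε)⌋₊ < m,
              ((μ m : ℝ) * Real.log m + Λ m)
            - ((g.natDegree - 1 + ε) * x * Real.log x
                - (g.natDegree - Real.log (|(g.leadingCoeff : ℝ)|) - γ) * x))
          =o[atTop] fun x : ℕ => (x : ℝ)) := by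
  have hirr : Irreducible g := by simpa using hg.irreducible 0
  have hd : 0 < g.natDegree := by omega
  have hg0 : ∀ n : ℕ, 1 ≤ n → g.eval (n : ℤ) ≠ 0 := fun n _ => eval_natCast_ne_zero_of_irreducible hirr hdeg n
  obtain ⟨γ, hlim, hA⟩ := locatedVonMangoldt_isLittleO hirr hd hg0 hε hε1
  refine ⟨γ, hlim, ?_⟩
  rw [batemanHornAsymptotic_iff_largeDivisorSum_isLittleO_rpowCut hg hdeg hε hε1]
  have hTVL : ∀ x : ℕ, (∑ n ∈ Icc 1 x, ∑ e ∈ ((g.eval (n : ℤ)).natAbs).divisors with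
        ⌊(x : ℝ) ^ (1 - ε)⌋₊ < (g.eval (n : ℤ)).natAbs / e,
        (μ ((g.eval (n : ℤ)).natAbs / e) : ℝ) * Real.log ((((g.eval (n : ℤ)).natAbs / e : ℕ)) : ℝ))
      = (∑ n ∈ Icc 1 x, ∑ m ∈ ((g.eval (n : ℤ)).natAbs.divisors) with ⌊(x : ℝ) ^ (1 - ε)⌋₊ < m,
          ((μ m : ℝ) * Real.log m + Λ m))
        - ∑ n ∈ Icc 1 x, ∑ e ∈ ((g.eval (n : ℤ)).natAbs.divisors).filter
            (fun e => ⌊(x : ℝ) ^ (1 - ε)⌋₊ < e), Λ e := by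
    intro x
    rw [eq_sub_iff_add_eq, ← sum_add_distrib]
    exact sum_congr rfl fun n _ => inner_moebiusLog_add_vonMangoldt _ _
  constructor
  · intro hT
    refine (hT.add hA).congr_left fun x => ?_
    rw [hTVL x]
    ring
  · intro hV
    refine (hV.sub hA).congr_left fun x => ?_
    rw [hTVL x]
    ring

/-- **Hardy–Littlewood's Conjecture E as a secondary-term statement** (`BatemanHorn`'s instance `X² + 1`):
`HL-E ⟺ ∑_{n ≤ x} ∑_{m ∣ n²+1, m > x^{1-ε}} (μ(m) log m + Λ(m)) = (1+ε) x log x - (2 - γ_{X²+1}) x + o(x)`,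
`γ_{X²+1}` being the Mertens constant of `X² + 1`: `∑_{e ≤ N} Λ(e) ρ(e)/e = log N - γ_{X²+1} + o(1)`
(numerically `γ_{X²+1} ≈ 1.6269`, secondary coefficient `2 - γ_{X²+1} ≈ 0.3731`). -/
theorem conjE_iff_compositeLayers {ε : ℝ} (hε : 0 < ε) (hε1 : ε < 1) :
    ∃ γ : ℝ,
      Tendsto (fun N : ℕ => ∑ e ∈ Icc 1 N, Λ e * (polyRootCountMod ![(X ^ 2 + 1 : ℤ[X])] e : ℝ) / e
        - Real.log N) atTop (𝓝 (-γ)) ∧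
      (BatemanHornAsymptotic ![(X ^ 2 + 1 : ℤ[X])] ↔
        (fun x : ℕ => ∑ n ∈ Icc 1 x, ∑ m ∈ (n ^ 2 + 1).divisors with ⌊(x : ℝ) ^ (1 - ε)⌋₊ < m,
              ((μ m : ℝ) * Real.log m + Λ m)
            - ((1 + ε) * x * Real.log x - (2 - γ) * x))
          =o[atTop] fun x : ℕ => (x : ℝ)) := by
  have hdeg2 : (X ^ 2 + 1 : ℤ[X]).natDegree = 2 := by
    simpa using natDegree_X_pow_add_C (n := 2) (r := (1 : ℤ))
  have hlc : (X ^ 2 + 1 : ℤ[X]).leadingCoeff = 1 := by simp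
  obtain ⟨γ, hlim, hiff⟩ := batemanHornAsymptotic_iff_compositeLayers
    Literature.NumberTheory.Sieve.isBatemanHornSystem_X_sq_add_one (by rw [hdeg2]) hε hε1
  refine ⟨γ, hlim, ?_⟩
  rw [hiff]
  have hN : ∀ n : ℕ, ((X ^ 2 + 1 : ℤ[X]).eval (n : ℤ)).natAbs = n ^ 2 + 1 := by
    intro n
    simp only [eval_add, eval_pow, eval_X, eval_one]
    norm_cast
  refine isLittleO_congr (Eventually.of_forall fun x => ?_) EventuallyEq.rfl
  simp only [hN, hdeg2, hlc, Int.cast_one, abs_one, Real.log_one, Nat.cast_ofNat]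
  ring

end LocatedMangoldt

end Summit.Parity.BatemanHorn.Theorems
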